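import Mathlib
import HarnessLib
import Summits.ValiantsHypothesis.ValiantsHypothesis.Theorems.LacunarySymmetroidMatrixDescartesOsculationCensusRankTwoCert
import Summits.ValiantsHypothesis.ValiantsHypothesis.Theorems.LacunarySymmetroidMatrixDescartesOsculationCensusRankOneLower

/-!
# ValiantsHypothesis / LacunarySymmetroid — crux `MatrixDescartes` (stmt-ValiantsHypothesis-18050, V1),
# line «osculation-law» (`Cruxes/MatrixDescartes/Lines/osculation_law.lean`), rung O3 «extremal-support families from the census»:
# the RANK-TWO-TOP LOWER CERTIFICATE (splitting `(2,0)`: osculation points EXHIBITED by sign changes of the cusp eliminant)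

Roster R2664 (b) / R2685 (O3 = val-sym-engine-7); critic val-idea-crit-1 VERDICT #76 («the O3 CONTENT is the LOWER side»).  Companion of
`…OsculationCensusRankTwoCert` (upper side at `(2,0)`: `N ≢ 0 ⇒ Finite ∧ ncard ≤ 24n`) and `…OsculationCensusRankOneLower` (lower side at rank one,
whose `exists_root_of_mul_nonpos` is reused).

CONTENT.  `OsculationCensus.osc_rankTwoTop_card_ge` (every `K`): for a `2 × 2` pencil on `Fin 2 ⊕ Fin 0` with `τ = tr G`, `δ = det G`, Hessian remainder
`A·b + B` (`OsculationCusp.hess_reduce_poly`) and cusp eliminant `N = B² − τAB + δA²`: a list of pairwise separated windows `(l,u)`, `0 < l ≤ u`, on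
each of which `A·B < 0` (so `A ≠ 0` and the candidate ordinate `b = −B/A` is positive) and at whose end-points `N` takes values of opposite sign
(`N(l)·N(u) ≤ 0`) yields `W.length` distinct osculation points (the line's `osculationSet d S`, UNFOLDED verbatim; assumed finite): IVT gives a zero
`t` of `N` in the window, `b = −B(t)/A(t) > 0` satisfies `Φ(t,b) = b² + τb + δ = N(t)/A(t)² = 0` and `H(t,b) = 0` because `A b + B = 0` (`hess_reduce_poly`).

HONEST FRAMING.  Calibration tooling for a line stub (`m = 2` is covered by `rungTwo`); the LAW `stub_osculationLaw`, the crux `MatrixDescartes`,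
Conjecture B and `VP ≠ VNP` are OPEN / NOT proved; no summit statement is proved by this file.  No definitions, no named facts; Mathlib + tree files.
-/

-- `Summit.ValiantsHypothesis.ValiantsHypothesis.…` is the tree's mandated single-conjunct layout (Sub = Summit).
set_option linter.dupNamespace false

noncomputable section

namespace Summit.ValiantsHypothesis.ValiantsHypothesis.Theorems.LacunarySymmetroidMatrixDescartes

open Polynomial Matrix Finset
open scoped BigOperators

namespace OsculationCensus

/-- **Rank-two-top LOWER certificate** (splitting `(2,0)`): separated sign-change windows of the cusp eliminant `N` with `A·B < 0` give that
many distinct osculation points (line vocabulary unfolded verbatim; the set is assumed finite; `A`, `B`, `N` are passed as variables with their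
defining equations `hA`, `hB`, `hN` — instances use `rfl`; `A = τ⁴·θ²τ − τ³·(θτ)² − τ³·θ²δ − 5τ²δ·θ²τ + 4τ²·θτ·θδ + τδ·(θτ)² + 4τδ·θ²δ
− 3τ·(θδ)² + 4δ²·θ²τ − 4δ·θτ·θδ` and `B = τ³δ·θ²τ − τ²δ·(θτ)² − τ²δ·θ²δ − 4τδ²·θ²τ + 4τδ·θτ·θδ + 4δ²·θ²δ − 4δ·(θδ)²` with `θ = X·d/dX`,
exactly the polynomials of `OsculationCusp.eval_A` / `eval_B`; `τ = G₀₀ + G₁₁`, `δ = G₀₀G₁₁ − G₀₁G₁₀` on the pencil entries). [folklore] -/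
theorem osc_rankTwoTop_card_ge {K : ℕ} (d : Fin K → ℕ) (S : Fin K → Matrix (Fin 2 ⊕ Fin 0) (Fin 2 ⊕ Fin 0) ℝ)
    (τ δ : ℝ[X])
    (hτ : (∑ l, (X : ℝ[X]) ^ d l • (S l).map Polynomial.C) (Sum.inl 0) (Sum.inl 0) + (∑ l, (X : ℝ[X]) ^ d l • (S l).map Polynomial.C) (Sum.inl 1) (Sum.inl 1) = τ)
    (hδ : (∑ l, (X : ℝ[X]) ^ d l • (S l).map Polynomial.C) (Sum.inl 0) (Sum.inl 0) * (∑ l, (X : ℝ[X]) ^ d l • (S l).map Polynomial.C) (Sum.inl 1) (Sum.inl 1) - (∑ l, (X : ℝ[X]) ^ d l • (S l).map Polynomial.C) (Sum.inl 0) (Sum.inl 1) * (∑ l, (X : ℝ[X]) ^ d l • (S l).map Polynomial.C) (Sum.inl 1) (Sum.inl 0) = δ)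
    (hfin :
    {p : Fin 2 → ℝ | 0 < p 0 ∧ 0 < p 1 ∧ MvPolynomial.eval p (∑ l, (MvPolynomial.X (0 : Fin 2) : MvPolynomial (Fin 2) ℝ) ^ d l •
              (S l).map (MvPolynomial.C : ℝ →+* MvPolynomial (Fin 2) ℝ)
            + (MvPolynomial.X (1 : Fin 2) : MvPolynomial (Fin 2) ℝ) •
              (Matrix.fromBlocks 1 0 0 0 : Matrix (Fin 2 ⊕ Fin 0) (Fin 2 ⊕ Fin 0) ℝ).map
                (MvPolynomial.C : ℝ →+* MvPolynomial (Fin 2) ℝ)).det = 0 ∧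
      MvPolynomial.eval p
        (MvPolynomial.X 0 * MvPolynomial.pderiv 0 (MvPolynomial.X 0 * MvPolynomial.pderiv 0 (∑ l, (MvPolynomial.X (0 : Fin 2) : MvPolynomial (Fin 2) ℝ) ^ d l •
              (S l).map (MvPolynomial.C : ℝ →+* MvPolynomial (Fin 2) ℝ)
            + (MvPolynomial.X (1 : Fin 2) : MvPolynomial (Fin 2) ℝ) •
              (Matrix.fromBlocks 1 0 0 0 : Matrix (Fin 2 ⊕ Fin 0) (Fin 2 ⊕ Fin 0) ℝ).map
                (MvPolynomial.C : ℝ →+* MvPolynomial (Fin 2) ℝ)).det)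
            * (MvPolynomial.X 1 * MvPolynomial.pderiv 1 (∑ l, (MvPolynomial.X (0 : Fin 2) : MvPolynomial (Fin 2) ℝ) ^ d l •
              (S l).map (MvPolynomial.C : ℝ →+* MvPolynomial (Fin 2) ℝ)
            + (MvPolynomial.X (1 : Fin 2) : MvPolynomial (Fin 2) ℝ) •
              (Matrix.fromBlocks 1 0 0 0 : Matrix (Fin 2 ⊕ Fin 0) (Fin 2 ⊕ Fin 0) ℝ).map
                (MvPolynomial.C : ℝ →+* MvPolynomial (Fin 2) ℝ)).det) ^ 2
          - 2 * (MvPolynomial.X 0 * MvPolynomial.pderiv 0 (MvPolynomial.X 1 * MvPolynomial.pderiv 1 (∑ l, (MvPolynomial.X (0 : Fin 2) : MvPolynomial (Fin 2) ℝ) ^ d l •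
              (S l).map (MvPolynomial.C : ℝ →+* MvPolynomial (Fin 2) ℝ)
            + (MvPolynomial.X (1 : Fin 2) : MvPolynomial (Fin 2) ℝ) •
              (Matrix.fromBlocks 1 0 0 0 : Matrix (Fin 2 ⊕ Fin 0) (Fin 2 ⊕ Fin 0) ℝ).map
                (MvPolynomial.C : ℝ →+* MvPolynomial (Fin 2) ℝ)).det))
            * (MvPolynomial.X 0 * MvPolynomial.pderiv 0 (∑ l, (MvPolynomial.X (0 : Fin 2) : MvPolynomial (Fin 2) ℝ) ^ d l •
              (S l).map (MvPolynomial.C : ℝ →+* MvPolynomial (Fin 2) ℝ)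
            + (MvPolynomial.X (1 : Fin 2) : MvPolynomial (Fin 2) ℝ) •
              (Matrix.fromBlocks 1 0 0 0 : Matrix (Fin 2 ⊕ Fin 0) (Fin 2 ⊕ Fin 0) ℝ).map
                (MvPolynomial.C : ℝ →+* MvPolynomial (Fin 2) ℝ)).det) * (MvPolynomial.X 1 * MvPolynomial.pderiv 1 (∑ l, (MvPolynomial.X (0 : Fin 2) : MvPolynomial (Fin 2) ℝ) ^ d l •
              (S l).map (MvPolynomial.C : ℝ →+* MvPolynomial (Fin 2) ℝ)
            + (MvPolynomial.X (1 : Fin 2) : MvPolynomial (Fin 2) ℝ) •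
              (Matrix.fromBlocks 1 0 0 0 : Matrix (Fin 2 ⊕ Fin 0) (Fin 2 ⊕ Fin 0) ℝ).map
                (MvPolynomial.C : ℝ →+* MvPolynomial (Fin 2) ℝ)).det)
          + MvPolynomial.X 1 * MvPolynomial.pderiv 1 (MvPolynomial.X 1 * MvPolynomial.pderiv 1 (∑ l, (MvPolynomial.X (0 : Fin 2) : MvPolynomial (Fin 2) ℝ) ^ d l •
              (S l).map (MvPolynomial.C : ℝ →+* MvPolynomial (Fin 2) ℝ)
            + (MvPolynomial.X (1 : Fin 2) : MvPolynomial (Fin 2) ℝ) •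
              (Matrix.fromBlocks 1 0 0 0 : Matrix (Fin 2 ⊕ Fin 0) (Fin 2 ⊕ Fin 0) ℝ).map
                (MvPolynomial.C : ℝ →+* MvPolynomial (Fin 2) ℝ)).det)
            * (MvPolynomial.X 0 * MvPolynomial.pderiv 0 (∑ l, (MvPolynomial.X (0 : Fin 2) : MvPolynomial (Fin 2) ℝ) ^ d l •
              (S l).map (MvPolynomial.C : ℝ →+* MvPolynomial (Fin 2) ℝ)
            + (MvPolynomial.X (1 : Fin 2) : MvPolynomial (Fin 2) ℝ) •
              (Matrix.fromBlocks 1 0 0 0 : Matrix (Fin 2 ⊕ Fin 0) (Fin 2 ⊕ Fin 0) ℝ).map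
                (MvPolynomial.C : ℝ →+* MvPolynomial (Fin 2) ℝ)).det) ^ 2) = 0}.Finite)
    (A B N : ℝ[X])
    (hA : A = (τ ^ 4 * (X * derivative (X * derivative τ)) - τ ^ 3 * (X * derivative τ) ^ 2 - τ ^ 3 * (X * derivative (X * derivative δ)) - 5 * τ ^ 2 * δ * (X * derivative (X * derivative τ)) + 4 * τ ^ 2 * (X * derivative τ) * (X * derivative δ) + τ * δ * (X * derivative τ) ^ 2 + 4 * τ * δ * (X * derivative (X * derivative δ)) - 3 * τ * (X * derivative δ) ^ 2 + 4 * δ ^ 2 * (X * derivative (X * derivative τ)) - 4 * δ * (X * derivative τ) * (X * derivative δ)))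
    (hB : B = (τ ^ 3 * δ * (X * derivative (X * derivative τ)) - τ ^ 2 * δ * (X * derivative τ) ^ 2 - τ ^ 2 * δ * (X * derivative (X * derivative δ)) - 4 * τ * δ ^ 2 * (X * derivative (X * derivative τ)) + 4 * τ * δ * (X * derivative τ) * (X * derivative δ) + 4 * δ ^ 2 * (X * derivative (X * derivative δ)) - 4 * δ * (X * derivative δ) ^ 2))
    (hN : N = B ^ 2 - τ * A * B + δ * A ^ 2)
    (W : List (ℝ × ℝ)) (hsep : W.Pairwise (fun a b => a.2 < b.1))
    (hW : ∀ w ∈ W, 0 < w.1 ∧ w.1 ≤ w.2 ∧ (∀ x, w.1 ≤ x → x ≤ w.2 → A.eval x * B.eval x < 0) ∧ N.eval w.1 * N.eval w.2 ≤ 0) :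
    W.length ≤
    {p : Fin 2 → ℝ | 0 < p 0 ∧ 0 < p 1 ∧ MvPolynomial.eval p (∑ l, (MvPolynomial.X (0 : Fin 2) : MvPolynomial (Fin 2) ℝ) ^ d l •
              (S l).map (MvPolynomial.C : ℝ →+* MvPolynomial (Fin 2) ℝ)
            + (MvPolynomial.X (1 : Fin 2) : MvPolynomial (Fin 2) ℝ) •
              (Matrix.fromBlocks 1 0 0 0 : Matrix (Fin 2 ⊕ Fin 0) (Fin 2 ⊕ Fin 0) ℝ).map
                (MvPolynomial.C : ℝ →+* MvPolynomial (Fin 2) ℝ)).det = 0 ∧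
      MvPolynomial.eval p
        (MvPolynomial.X 0 * MvPolynomial.pderiv 0 (MvPolynomial.X 0 * MvPolynomial.pderiv 0 (∑ l, (MvPolynomial.X (0 : Fin 2) : MvPolynomial (Fin 2) ℝ) ^ d l •
              (S l).map (MvPolynomial.C : ℝ →+* MvPolynomial (Fin 2) ℝ)
            + (MvPolynomial.X (1 : Fin 2) : MvPolynomial (Fin 2) ℝ) •
              (Matrix.fromBlocks 1 0 0 0 : Matrix (Fin 2 ⊕ Fin 0) (Fin 2 ⊕ Fin 0) ℝ).map
                (MvPolynomial.C : ℝ →+* MvPolynomial (Fin 2) ℝ)).det)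
            * (MvPolynomial.X 1 * MvPolynomial.pderiv 1 (∑ l, (MvPolynomial.X (0 : Fin 2) : MvPolynomial (Fin 2) ℝ) ^ d l •
              (S l).map (MvPolynomial.C : ℝ →+* MvPolynomial (Fin 2) ℝ)
            + (MvPolynomial.X (1 : Fin 2) : MvPolynomial (Fin 2) ℝ) •
              (Matrix.fromBlocks 1 0 0 0 : Matrix (Fin 2 ⊕ Fin 0) (Fin 2 ⊕ Fin 0) ℝ).map
                (MvPolynomial.C : ℝ →+* MvPolynomial (Fin 2) ℝ)).det) ^ 2
          - 2 * (MvPolynomial.X 0 * MvPolynomial.pderiv 0 (MvPolynomial.X 1 * MvPolynomial.pderiv 1 (∑ l, (MvPolynomial.X (0 : Fin 2) : MvPolynomial (Fin 2) ℝ) ^ d l •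
              (S l).map (MvPolynomial.C : ℝ →+* MvPolynomial (Fin 2) ℝ)
            + (MvPolynomial.X (1 : Fin 2) : MvPolynomial (Fin 2) ℝ) •
              (Matrix.fromBlocks 1 0 0 0 : Matrix (Fin 2 ⊕ Fin 0) (Fin 2 ⊕ Fin 0) ℝ).map
                (MvPolynomial.C : ℝ →+* MvPolynomial (Fin 2) ℝ)).det))
            * (MvPolynomial.X 0 * MvPolynomial.pderiv 0 (∑ l, (MvPolynomial.X (0 : Fin 2) : MvPolynomial (Fin 2) ℝ) ^ d l •
              (S l).map (MvPolynomial.C : ℝ →+* MvPolynomial (Fin 2) ℝ)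
            + (MvPolynomial.X (1 : Fin 2) : MvPolynomial (Fin 2) ℝ) •
              (Matrix.fromBlocks 1 0 0 0 : Matrix (Fin 2 ⊕ Fin 0) (Fin 2 ⊕ Fin 0) ℝ).map
                (MvPolynomial.C : ℝ →+* MvPolynomial (Fin 2) ℝ)).det) * (MvPolynomial.X 1 * MvPolynomial.pderiv 1 (∑ l, (MvPolynomial.X (0 : Fin 2) : MvPolynomial (Fin 2) ℝ) ^ d l •
              (S l).map (MvPolynomial.C : ℝ →+* MvPolynomial (Fin 2) ℝ)
            + (MvPolynomial.X (1 : Fin 2) : MvPolynomial (Fin 2) ℝ) •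
              (Matrix.fromBlocks 1 0 0 0 : Matrix (Fin 2 ⊕ Fin 0) (Fin 2 ⊕ Fin 0) ℝ).map
                (MvPolynomial.C : ℝ →+* MvPolynomial (Fin 2) ℝ)).det)
          + MvPolynomial.X 1 * MvPolynomial.pderiv 1 (MvPolynomial.X 1 * MvPolynomial.pderiv 1 (∑ l, (MvPolynomial.X (0 : Fin 2) : MvPolynomial (Fin 2) ℝ) ^ d l •
              (S l).map (MvPolynomial.C : ℝ →+* MvPolynomial (Fin 2) ℝ)
            + (MvPolynomial.X (1 : Fin 2) : MvPolynomial (Fin 2) ℝ) •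
              (Matrix.fromBlocks 1 0 0 0 : Matrix (Fin 2 ⊕ Fin 0) (Fin 2 ⊕ Fin 0) ℝ).map
                (MvPolynomial.C : ℝ →+* MvPolynomial (Fin 2) ℝ)).det)
            * (MvPolynomial.X 0 * MvPolynomial.pderiv 0 (∑ l, (MvPolynomial.X (0 : Fin 2) : MvPolynomial (Fin 2) ℝ) ^ d l •
              (S l).map (MvPolynomial.C : ℝ →+* MvPolynomial (Fin 2) ℝ)
            + (MvPolynomial.X (1 : Fin 2) : MvPolynomial (Fin 2) ℝ) •
              (Matrix.fromBlocks 1 0 0 0 : Matrix (Fin 2 ⊕ Fin 0) (Fin 2 ⊕ Fin 0) ℝ).map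
                (MvPolynomial.C : ℝ →+* MvPolynomial (Fin 2) ℝ)).det) ^ 2) = 0}.ncard := by
  classical
  have hΦ := OsculationTwoK.insertionPoly_two_zero K d S
  rw [hτ, hδ] at hΦ
  rw [hΦ] at hfin ⊢
  set Φ : MvPolynomial (Fin 2) ℝ := MvPolynomial.X 1 * MvPolynomial.X 1
      + MvPolynomial.X 1 * Polynomial.aeval (MvPolynomial.X 0 : MvPolynomial (Fin 2) ℝ) τ
      + Polynomial.aeval (MvPolynomial.X 0 : MvPolynomial (Fin 2) ℝ) δ with hΦdef
  set osc := {p : Fin 2 → ℝ | 0 < p 0 ∧ 0 < p 1 ∧ MvPolynomial.eval p Φ = 0 ∧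
      MvPolynomial.eval p
        (MvPolynomial.X 0 * MvPolynomial.pderiv 0 (MvPolynomial.X 0 * MvPolynomial.pderiv 0 Φ)
            * (MvPolynomial.X 1 * MvPolynomial.pderiv 1 Φ) ^ 2
          - 2 * (MvPolynomial.X 0 * MvPolynomial.pderiv 0 (MvPolynomial.X 1 * MvPolynomial.pderiv 1 Φ))
            * (MvPolynomial.X 0 * MvPolynomial.pderiv 0 Φ) * (MvPolynomial.X 1 * MvPolynomial.pderiv 1 Φ)
          + MvPolynomial.X 1 * MvPolynomial.pderiv 1 (MvPolynomial.X 1 * MvPolynomial.pderiv 1 Φ)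
            * (MvPolynomial.X 0 * MvPolynomial.pderiv 0 Φ) ^ 2) = 0} with hosc
  have mem_osc : ∀ p : Fin 2 → ℝ, p ∈ osc ↔ 0 < p 0 ∧ 0 < p 1 ∧
      p 1 ^ 2 + p 1 * τ.eval (p 0) + δ.eval (p 0) = 0 ∧
      (((p 0) * (derivative τ).eval (p 0) + (p 0) ^ 2 * (derivative (derivative τ)).eval (p 0)) * (p 1) + ((p 0) * (derivative δ).eval (p 0) + (p 0) ^ 2 * (derivative (derivative δ)).eval (p 0))) * (2 * (p 1) ^ 2 + τ.eval (p 0) * (p 1)) ^ 2 - 2 * (((p 0) * (derivative τ).eval (p 0)) * (p 1)) * (((p 0) * (derivative τ).eval (p 0)) * (p 1) + ((p 0) * (derivative δ).eval (p 0))) * (2 * (p 1) ^ 2 + τ.eval (p 0) * (p 1)) + (4 * (p 1) ^ 2 + τ.eval (p 0) * (p 1)) * (((p 0) * (derivative τ).eval (p 0)) * (p 1) + ((p 0) * (derivative δ).eval (p 0))) ^ 2 = 0 := by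
    intro p
    rw [hosc, Set.mem_setOf_eq, OsculationCusp.eval_logHessian_Phi2 τ δ Φ hΦdef p, hΦdef, OsculationCusp.eval_Phi2]
  -- index the windows
  set k := W.length with hk
  set l : Fin k → ℝ := fun i => (W.get i).1 with hl
  set u : Fin k → ℝ := fun i => (W.get i).2 with hu
  have hWi : ∀ i : Fin k, 0 < l i ∧ l i ≤ u i ∧ (∀ x, l i ≤ x → x ≤ u i → A.eval x * B.eval x < 0) ∧
      N.eval (l i) * N.eval (u i) ≤ 0 := fun i => by
    simpa [hl, hu] using hW (W.get i) (List.get_mem W i)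
  have hsep' : ∀ i j : Fin k, i < j → u i < l j := by
    intro i j hij
    have := List.pairwise_iff_get.1 hsep i j hij
    simpa [hl, hu] using this
  have hroot : ∀ i, ∃ t, l i ≤ t ∧ t ≤ u i ∧ N.eval t = 0 := fun i =>
    exists_root_of_mul_nonpos N (hWi i).2.1 (hWi i).2.2.2
  choose t ht using hroot
  set pt : Fin k → (Fin 2 → ℝ) := fun i => ![t i, -B.eval (t i) / A.eval (t i)] with hpt
  have hmem : ∀ i, pt i ∈ osc := by
    intro i
    obtain ⟨htl, htu, hNt⟩ := ht i
    have hs := (hWi i).2.2.1 (t i) htl htu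
    have hA0 : A.eval (t i) ≠ 0 := fun h => by rw [h, zero_mul] at hs; exact lt_irrefl _ hs
    have ht0 : 0 < t i := lt_of_lt_of_le (hWi i).1 htl
    have hb : 0 < -B.eval (t i) / A.eval (t i) := by
      have hA2 : 0 < A.eval (t i) ^ 2 := by positivity
      have : -B.eval (t i) / A.eval (t i) = -(A.eval (t i) * B.eval (t i)) / A.eval (t i) ^ 2 := by
        field_simp
      rw [this]
      exact div_pos (by linarith) hA2
    -- on the curve: `Φ(t, -B/A) = N/A² = 0`
    have hN' : B.eval (t i) ^ 2 - τ.eval (t i) * A.eval (t i) * B.eval (t i) + δ.eval (t i) * A.eval (t i) ^ 2 = 0 := by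
      have := hNt
      rw [hN] at this
      simpa [eval_sub, eval_add, eval_mul, eval_pow] using this
    have hcurve : (-B.eval (t i) / A.eval (t i)) ^ 2 + (-B.eval (t i) / A.eval (t i)) * τ.eval (t i) + δ.eval (t i) = 0 := by
      field_simp
      linear_combination hN'
    -- the Hessian vanishes: `A b + B = 0`
    have hlin : A.eval (t i) * (-B.eval (t i) / A.eval (t i)) + B.eval (t i) = 0 := by
      field_simp
      ring
    refine (mem_osc (pt i)).2 ⟨?_, ?_, ?_, ?_⟩
    · simpa [hpt] using ht0
    · simpa [hpt] using hb
    · simpa [hpt] using hcurve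
    · have key := (OsculationCusp.hess_reduce_poly τ δ (t i) (-B.eval (t i) / A.eval (t i)) hcurve).2 (by rw [← hA, ← hB]; exact hlin)
      simpa [hpt] using key
  have hinj : Function.Injective pt := by
    intro i j hij
    have h0 : t i = t j := by
      have := congr_fun hij 0
      simpa [hpt] using this
    by_contra hne
    rcases lt_or_gt_of_ne hne with h | h
    · have := hsep' i j h
      linarith [(ht i).2.1, (ht j).1]
    · have := hsep' j i h
      linarith [(ht j).2.1, (ht i).1]
  have hsub : ↑(Finset.univ.image pt) ⊆ osc := by
    intro p hp
    rw [Finset.mem_coe, Finset.mem_image] at hp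
    obtain ⟨i, -, rfl⟩ := hp
    exact hmem i
  calc k = (Finset.univ.image pt).card := by rw [Finset.card_image_of_injective _ hinj, Finset.card_univ, Fintype.card_fin]
    _ = (↑(Finset.univ.image pt) : Set (Fin 2 → ℝ)).ncard := (Set.ncard_coe_finset _).symm
    _ ≤ osc.ncard := Set.ncard_le_ncard hsub hfin

end OsculationCensus

end Summit.ValiantsHypothesis.ValiantsHypothesis.Theorems.LacunarySymmetroidMatrixDescartes
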